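import Summits.PneNP.PneNP.Theorems.ChebyshevTracialDesignHalfPinnedNull
import Literature.Combinatorics.Optimization.ShellLawHalfPinningTwo
import HarnessLib

/-!
# Cell pnp-psdrank, route `ChebyshevTracialDesign`: PAIR-OF-CROSSINGS-WEIGHTED BLOCK STATISTICS ARE VIRTUALLY NULL — the design value of
# `ψ(|U∩H|)·Y(Y−1)`, `Y = |half_M(U) ∩ H|`, is a pure interpolation remainder (crux `TracialDecayExp20`, stmt-PneNP-19878)

Brick 119b (prover g22; MEMO-25 §2(c)(iii)). Companion of brick 119 (`…HalfPinnedNull`, ONE crossing `H`-vertex pinned). In the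
crossing-plane decomposition of the tilted mask `ψ(X)·C_u²` (Literature `crossingWeight_containment_eq`:
`C_u = 2λ(X − Y) + (μ−λ)(t−c)`) the square of the half count enters through `Y² = Y + Y(Y−1)`; `Y(Y−1)` counts ORDERED PAIRS of
crossing `H`-vertices, and pinning such a pair (Literature `ShellLawHalfPinningTwo`: `shellInAvg_halfPairs_blockStat_eq`) gives the
shell profile `φ_M(c) = (c(c−1)/(n(n−2)))·Σ_{v∈H} Σ_{w∈H∖e_v} φ″_{vw}(c−2)` with `φ″_{vw}` the shell profile of the shifted block statistic
`ψ(·+2)` on the doubly deleted ground set `[n] ∖ e_v ∖ e_w`, at the ODD cut size `t−2` and odd levels `c−2`. The level factor `c(c−1)`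
vanishes at the virtual level, so brick 119's `abs_levelSum_levelMul_le` applies with `θ(c) = (c−1)·(…)`:

* §1 `fwdDiff_iter_twoMul` (`Δ^k[2j·h(j)](y) = 2y·Δ^k h(y) + 2k·Δ^{k−1}h(y+1)`), `fwdDiff_iter_predShift`
  (`Δ^k[j ↦ G(2j−1)](y+1) = Δ^k[i ↦ G(2i+1)](y)` — the level shift `c ↦ c−2` is the node shift `j ↦ j−1`).
* §2 **`abs_fwdDiff_iter_del2Profile_le`**: `|Δ^k_{(2)} φ″_{vw}(c″)| ≤ G·ρ^k·X_k` (Literature iterated `ℓ¹` bound on `[n] ∖ e_v ∖ e_w`;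
  nonemptiness from the shells of `M` two levels up).
* §3 **`abs_designValue_halfPairs_blockStat_le`** (THE THEOREM): for every exact design `(n,t,T,D,B_v,C,w)`, matching `M`, block `H`,
  `|ψ| ≤ G` on `[0,t]`: `| |PM|·Σ_U W(U,M)·Y(Y−1)·ψ(|U∩H|) | ≤ (2D+1)(C(2D,D)/4^D)·K_D + B_v·C((T−1)/2,D+1)·(T·K_{D+1} + 2(D+1)·K_D)`
  with `K_k = (|H|²/(n(n−2)))·G·(T·ρ^k X_k + 2k·ρ^{k−1} X_{k−1})`, `X_k` the `x`-smoothness numbers of the `k`-fold-deleted shell laws of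
  the doubly deleted ground sets (odd base levels) — a PURE REMAINDER of orders `D−1, D, D+1`: no tight-shell term, no `O(G/n)` corrections.
With brick 119 this prices every half-count term of the crossing-plane decomposition (MEMO-25 §2(c)(ii)(iii)); what remains of the
tilted mask is a plain block statistic with level-polynomial coefficients (brick 120). WHAT THIS FILE DOES NOT DO: brick 120's
assembly; bound the `X_k` (bricks 118); anything on `TracialDecayExp20` itself, psd rank, or P vs NP.
[cite: Rothvoss2017, §2 (PDF p. 6)] [cite: Agarwal2000DifferenceEquations, Thm. 1.8.5 (1.8.6), Remark 1.8.1 (1.8.8)]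
[cite: Boole2009, Ch. II Art. 10 Ex. 3 eq. (8) (PDF pp. 34–35)] [cite: GriblingDelaatLaurent2019, §5]
Stature: support/instrument (kernel lane, no defs, axioms standard). Supports stmt-PneNP-19878.
-/

set_option linter.dupNamespace false -- `Summit.PneNP.PneNP.…`: summit = sub-problem (D-0017)

noncomputable section

namespace Summit.PneNP.PneNP.Theorems.ChebyshevTracialDesignHalfPairsNull

open Finset Polynomial Literature.Barriers.PneNP Literature.Combinatorics.Optimization
open Literature.Combinatorics.Optimization.ShellStep
open Summit.PneNP.PneNP.Theorems.ChebyshevTracialDesignShellOperatorForm (designValue_eq_shellAvg shell_partner_nonempty)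
open Summit.PneNP.PneNP.Theorems.ChebyshevTracialDesignBlockStatisticPricing (fwdDiff_iter_one_odd pairs_hyp rho_nonneg)
open Summit.PneNP.PneNP.Theorems.ChebyshevTracialDesignHalfPinnedNull (fwdDiff_iter_levelMul fwdDiff_iter_mul_sum
  abs_levelSum_levelMul_le)

variable {n : ℕ}

/-! ### §1 Difference calculus for the factor `c − 1` and the level shift `c ↦ c − 2` -/

/-- **Leibniz for the factor `2j`**: `Δ^k[2j·h(j)](y) = 2y·Δ^k h(y) + 2k·Δ^{k−1} h(y+1)`.
[cite: Boole2009, Ch. II Art. 10 Ex. 3 eq. (8) (PDF pp. 34–35)] -/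
theorem fwdDiff_iter_twoMul (h : ℕ → ℝ) (k y : ℕ) :
    (fwdDiff (1 : ℕ))^[k] (fun j : ℕ => 2 * (j : ℝ) * h j) y =
      2 * (y : ℝ) * (fwdDiff (1 : ℕ))^[k] h y + 2 * (k : ℝ) * (fwdDiff (1 : ℕ))^[k - 1] h (y + 1) := by
  have hsplit : (fun j : ℕ => 2 * (j : ℝ) * h j) = (fun j : ℕ => (2 * (j : ℝ) + 1) * h j) + ((-1 : ℝ) • h) := by
    funext j; simp only [Pi.add_apply, Pi.smul_apply, smul_eq_mul]; ring
  rw [hsplit, fwdDiff_iter_add, fwdDiff_iter_const_smul, Pi.add_apply, Pi.smul_apply, smul_eq_mul, fwdDiff_iter_levelMul]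
  ring

/-- **The level shift is a node shift**: `Δ^k[j ↦ G(2j−1)](y+1) = Δ^k[i ↦ G(2i+1)](y)`.
[cite: Agarwal2000DifferenceEquations, Thm. 1.8.5 (1.8.6)] -/
theorem fwdDiff_iter_predShift (G : ℕ → ℝ) (k y : ℕ) :
    (fwdDiff (1 : ℕ))^[k] (fun j : ℕ => G (2 * j - 1)) (y + 1) = (fwdDiff (1 : ℕ))^[k] (fun i : ℕ => G (2 * i + 1)) y := by
  rw [fwdDiff_iter_eq_sum_shift, fwdDiff_iter_eq_sum_shift]
  refine sum_congr rfl fun i _ => ?_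
  simp only [smul_eq_mul, mul_one]
  congr 2
  omega

/-! ### §2 Level differences of a doubly deleted, shifted block-statistic profile -/

/-- **Level differences of a doubly deleted, shifted block-statistic profile.** For a perfect matching `M` (partner map `π`),
vertices `v, w` on different edges, a block `H`, `|ψ(·+2)| ≤ G` on `[0, t″]`, an ODD cut size `t″ = t₀″ + 2k` and an odd level `c″`
with `c″ + 2k ≤ t″`, `t″ + 2 + (c″ + 2k + 2) ≤ n`, `m ≥ 3`, `m + 4k + 4 ≤ n`: if every `π`-stable `S′` with `|S′| + 4k + 4 = n` has
`Σ_{x=0}^{t″} |(∇²)^k law_{S′}(t₀″,·)(c″)(x)| ≤ X`, then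
`|Δ^k_{(2)}[c ↦ E_{Shell_{[n]∖e_v∖e_w}(t″,c)}[ψ(|W∩H|+2)]](c″)| ≤ G·ρ^k·X`, `ρ = m/(4(m−2))`.
[cite: Rothvoss2017, §2 (PDF p. 6)] [cite: RollinRoss2010, §3 (Lemma 3.1)] -/
theorem abs_fwdDiff_iter_del2Profile_le (M : PMatch n) {v w : Fin n} (hwv : w ≠ v) (hwπ : w ≠ M.2.partner v)
    (H : Finset (Fin n)) (ψ : ℤ → ℝ) {G : ℝ} (hG0 : 0 ≤ G) {t₀'' k c'' m : ℕ}
    (hG : ∀ x ∈ Icc (0 : ℤ) ((t₀'' + 2 * k : ℕ) : ℤ), |ψ (x + 2)| ≤ G)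
    (ht : Odd (t₀'' + 2 * k)) (hc : Odd c'') (hct : c'' + 2 * k ≤ t₀'' + 2 * k)
    (hn : t₀'' + 2 * k + 2 + (c'' + 2 * k + 2) ≤ n) (hm : 3 ≤ m) (hmn : m + 4 * k + 4 ≤ n) {X : ℝ} (hX0 : 0 ≤ X)
    (hX : ∀ S' : Finset (Fin n), (∀ u ∈ S', M.2.partner u ∈ S') → S'.card + 4 * k + 4 = n →
      ∑ x ∈ Icc (0 : ℤ) ((t₀'' + 2 * k : ℕ) : ℤ),
        |nab2^[k] (fun c x => shellLaw M.2.partner S' H t₀'' c x : Profile) c'' x| ≤ X) :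
    |((fwdDiff (2 : ℕ))^[k] (fun c => (∑ W ∈ shellIn M.2.partner (del2 M.2.partner univ v w) (t₀'' + 2 * k) c,
        ψ (((W ∩ H).card : ℤ) + 2)) / ((shellIn M.2.partner (del2 M.2.partner univ v w) (t₀'' + 2 * k) c).card : ℝ))) c''| ≤
      G * (((m : ℝ) / (4 * ((m : ℝ) - 2))) ^ k * X) := by
  set π := M.2.partner with hπdef
  have hπ : ∀ v, π (π v) = v := partner_partner M
  have hπ' : ∀ v, π v ≠ v := partner_ne M
  have hU : ∀ u ∈ (univ : Finset (Fin n)), π u ∈ (univ : Finset (Fin n)) := fun u _ => mem_univ _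
  set S : Finset (Fin n) := del2 π univ v w with hSdef
  have hS : ∀ u ∈ S, π u ∈ S := del2_stable hπ hU v w
  have hScard : S.card + 4 = n := by
    have := card_del2_add_four hπ hπ' hU (mem_univ v) (mem_univ w) hwv hwπ
    rwa [card_univ, Fintype.card_fin] at this
  refine (abs_fwdDiff_iter_shellInAvg_le S H (t₀'' + 2 * k) k c'' (fun x => ψ (x + 2)) hG).trans
    (mul_le_mul_of_nonneg_left ?_ hG0)
  have hρ0 : (0 : ℝ) ≤ (m : ℝ) / (4 * ((m : ℝ) - 2)) := rho_nonneg hm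
  -- nonemptiness of the doubly deleted shell at the top level, from the shell of `M` two levels up
  have hne : (shellIn π S (t₀'' + 2 * k) (c'' + 2 * k)).Nonempty := by
    refine shellIn_del2_nonempty_of_half hπ hπ' hU (mem_univ v) (mem_univ w) hwv hwπ ?_
    rw [shellIn_univ]
    exact shell_partner_nonempty M (by obtain ⟨i, hi⟩ := ht; exact ⟨i + 1, by omega⟩)
      (by obtain ⟨i, hi⟩ := hc; exact ⟨i + k + 1, by omega⟩) (by omega) hn
  have h := sum_abs_nab2_iter_fwdDiff_iter_le hπ hπ' H t₀'' (Icc (0 : ℤ) ((t₀'' + 2 * k : ℕ) : ℤ)) hρ0 hX0 k 0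
    hS c'' hne
    (fun S' _ hS' hlt => pairs_hyp hπ H hm S' hS' (by omega))
    (fun S' _ hS' heq => by
      rw [zero_add]
      exact hX S' hS' (by omega))
  simpa using h

/-! ### §3 The pair-of-crossings-weighted block statistic `ψ(|U∩H|)·Y(Y−1)` -/

/-- **The shell profile of `ψ(|U∩H|)·Y(Y−1)` at a matching.** For a perfect matching `M` (partner map `π`), an odd cut size
`t = t₀ + 2` and an odd level `c = c₀ + 2` with `c ≤ t`, `t + c ≤ n`:
`E_{Shell_c(M)}[Y(Y−1)·ψ(|U∩H|)] = (c(c−1)/(n(n−2)))·Σ_{v∈H} Σ_{w∈H∖e_v} E_{Shell_{[n]∖e_v∖e_w}(t₀,c₀)}[ψ(|W∩H|+2)]`.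
[cite: Rothvoss2017, §2 (PDF p. 6)] -/
theorem shellAvg_halfPairs_blockStat_eq (M : PMatch n) (H : Finset (Fin n)) (ψ : ℤ → ℝ) {t₀ c₀ : ℕ}
    (ht : Odd (t₀ + 2)) (hc : Odd (c₀ + 2)) (hct : c₀ + 2 ≤ t₀ + 2) (hn : t₀ + 2 + (c₀ + 2) ≤ n) :
    (∑ U ∈ shell M.2.partner (t₀ + 2) (c₀ + 2), ((half M.2.partner U ∩ H).card : ℝ) *
        (((half M.2.partner U ∩ H).card : ℝ) - 1) * ψ ((U ∩ H).card : ℤ)) /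
        ((shell M.2.partner (t₀ + 2) (c₀ + 2)).card : ℝ) =
      ((((c₀ : ℝ) + 2) * ((c₀ : ℝ) + 1)) / ((n : ℝ) * ((n : ℝ) - 2))) * ∑ v ∈ H, ∑ w ∈ H \ {v, M.2.partner v},
        (∑ W ∈ shellIn M.2.partner (del2 M.2.partner univ v w) t₀ c₀, ψ (((W ∩ H).card : ℤ) + 2)) /
          ((shellIn M.2.partner (del2 M.2.partner univ v w) t₀ c₀).card : ℝ) := by
  have hπ : ∀ v, M.2.partner (M.2.partner v) = v := partner_partner M
  have hπ' : ∀ v, M.2.partner v ≠ v := partner_ne M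
  have hne : (shellIn M.2.partner univ (t₀ + 2) (c₀ + 2)).Nonempty := by
    rw [shellIn_univ]; exact shell_partner_nonempty M ht hc hct hn
  have h := shellInAvg_halfPairs_blockStat_eq hπ hπ' (S := univ) (fun u _ => mem_univ _) H t₀ c₀ ψ hne
  rw [shellIn_univ, univ_inter, card_univ, Fintype.card_fin] at h
  exact h

/-- **PAIR-OF-CROSSINGS-WEIGHTED BLOCK STATISTICS ARE VIRTUALLY NULL (brick 119b).** For an exact design `(n,t,T,D,B_v,C,w)`
with `t = t₀″ + 2(D+1) + 2`, a perfect matching `M` (partner map `π`), a block `H`, `|ψ| ≤ G` on `[0,t]`, `m ≥ 3`, `m + 4(D+1) + 4 ≤ n`,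
`2D+1 ≤ T`, and `x`-smoothness numbers `X_k ≥ 0` (`k ∈ {D−1, D, D+1}`, odd base levels `c″` with `c″ + 2k + 2 ≤ T`, every `π`-stable
`S′` with `|S′| + 4k + 4 = n`, cut `t − 2 − 2k`): `| |PM|·Σ_U W(U,M)·Y(Y−1)·ψ(|U∩H|) |` (`Y = |half_M U ∩ H|`) is at most
`(2D+1)(C(2D,D)/4^D)·K_D + B_v·C((T−1)/2,D+1)·(T·K_{D+1} + 2(D+1)·K_D)`, `K_k = (|H|²/(n(n−2)))·G·(T·ρ^k X_k + 2k·ρ^{k−1} X_{k−1})`.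
[cite: Rothvoss2017, §2 (PDF p. 6)] [cite: Agarwal2000DifferenceEquations, Thm. 1.8.5 (1.8.6), Remark 1.8.1 (1.8.8)]
[cite: GriblingDelaatLaurent2019, §5] -/
theorem abs_designValue_halfPairs_blockStat_le {t₀'' T D : ℕ} {Bv : ℝ} {C : Finset ℕ} {w : ℕ → ℝ}
    (hdes : IsExactDesign n (t₀'' + 2 * (D + 1) + 2) T D Bv C w) (hDT : 2 * D + 1 ≤ T) (M : PMatch n)
    (H : Finset (Fin n)) (ψ : ℤ → ℝ) {G : ℝ} (hG0 : 0 ≤ G)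
    (hG : ∀ x ∈ Icc (0 : ℤ) ((t₀'' + 2 * (D + 1) + 2 : ℕ) : ℤ), |ψ x| ≤ G)
    {m : ℕ} (hm : 3 ≤ m) (hmn : m + 4 * (D + 1) + 4 ≤ n) (X : ℕ → ℝ) (hX0 : ∀ k, 0 ≤ X k)
    (hX : ∀ k, D ≤ k + 1 → k ≤ D + 1 → ∀ c'' : ℕ, Odd c'' → c'' + 2 * k + 2 ≤ T →
      ∀ S' : Finset (Fin n), (∀ u ∈ S', M.2.partner u ∈ S') → S'.card + 4 * k + 4 = n →
      ∑ x ∈ Icc (0 : ℤ) ((t₀'' + 2 * (D + 1) : ℕ) : ℤ),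
        |nab2^[k] (fun c x => shellLaw M.2.partner S' H (t₀'' + 2 * (D + 1) - 2 * k) c x : Profile) c'' x| ≤ X k) :
    |(Fintype.card (PMatch n) : ℝ) * ∑ U : OddSet n, levelWeight n (t₀'' + 2 * (D + 1) + 2) C w U M *
        (((half M.2.partner U.1 ∩ H).card : ℝ) * (((half M.2.partner U.1 ∩ H).card : ℝ) - 1) * ψ ((U.1 ∩ H).card : ℤ))| ≤
      (2 * (D : ℝ) + 1) * ((((2 * D).choose D : ℕ) : ℝ) / (4 : ℝ) ^ D) *
          (((H.card : ℝ) ^ 2 / ((n : ℝ) * ((n : ℝ) - 2))) * (G * ((T : ℝ) * (((m : ℝ) / (4 * ((m : ℝ) - 2))) ^ D * X D) +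
            2 * (D : ℝ) * (((m : ℝ) / (4 * ((m : ℝ) - 2))) ^ (D - 1) * X (D - 1))))) +
        Bv * ((((T - 1) / 2).choose (D + 1) : ℕ) : ℝ) *
          ((T : ℝ) * (((H.card : ℝ) ^ 2 / ((n : ℝ) * ((n : ℝ) - 2))) *
              (G * ((T : ℝ) * (((m : ℝ) / (4 * ((m : ℝ) - 2))) ^ (D + 1) * X (D + 1)) +
                2 * ((D : ℝ) + 1) * (((m : ℝ) / (4 * ((m : ℝ) - 2))) ^ D * X D)))) +
            2 * ((D : ℝ) + 1) * (((H.card : ℝ) ^ 2 / ((n : ℝ) * ((n : ℝ) - 2))) *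
              (G * ((T : ℝ) * (((m : ℝ) / (4 * ((m : ℝ) - 2))) ^ D * X D) +
                2 * (D : ℝ) * (((m : ℝ) / (4 * ((m : ℝ) - 2))) ^ (D - 1) * X (D - 1)))))) := by
  set t₀ := t₀'' + 2 * (D + 1) with ht₀def
  set π := M.2.partner with hπdef
  set ρ : ℝ := (m : ℝ) / (4 * ((m : ℝ) - 2)) with hρdef
  set κ : ℝ := 1 / ((n : ℝ) * ((n : ℝ) - 2)) with hκdef
  have ht : Odd (t₀ + 2) := hdes.1
  have ht₀ : Odd t₀ := by obtain ⟨i, hi⟩ := ht; exact ⟨i - 1, by omega⟩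
  have h2t : 2 * (t₀ + 2) + 2 ≤ n := hdes.2.1
  have hTt : T ≤ t₀ + 2 := hdes.2.2.1
  have hPM : (0 : ℝ) < (Fintype.card (PMatch n) : ℝ) := by
    have : 0 < Fintype.card (PMatch n) := Fintype.card_pos_iff.2 ⟨M⟩
    exact_mod_cast this
  have hn4 : (4 : ℝ) ≤ n := by
    have : 4 ≤ n := by omega
    exact_mod_cast this
  have hκ0 : 0 ≤ κ := by rw [hκdef]; exact div_nonneg zero_le_one (mul_nonneg (by linarith) (by linarith))
  have hρ0 : 0 ≤ ρ := rho_nonneg hm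
  -- the doubly deleted, shifted profiles and `θ`
  set φ'' : Fin n → Fin n → ℕ → ℝ := fun v w c =>
    (∑ W ∈ shellIn π (del2 π univ v w) t₀ c, ψ (((W ∩ H).card : ℤ) + 2)) /
      ((shellIn π (del2 π univ v w) t₀ c).card : ℝ) with hφ''
  set Gs : ℕ → ℝ := fun c => κ * ∑ v ∈ H, ∑ w ∈ H \ {v, π v}, φ'' v w c with hGs
  set θ : ℕ → ℝ := fun c => ((c : ℝ) - 1) * Gs (c - 2) with hθ
  -- Step 1: `|PM|·Σ_U W g = Σ_c w_c (c·θ(c))`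
  have hval : (Fintype.card (PMatch n) : ℝ) * ∑ U : OddSet n, levelWeight n (t₀ + 2) C w U M *
      (((half π U.1 ∩ H).card : ℝ) * (((half π U.1 ∩ H).card : ℝ) - 1) * ψ ((U.1 ∩ H).card : ℤ)) =
      ∑ c ∈ C, w c * ((c : ℝ) * θ c) := by
    rw [designValue_eq_shellAvg (t₀ + 2) ht C w M
      (fun U => ((half π U ∩ H).card : ℝ) * (((half π U ∩ H).card : ℝ) - 1) * ψ ((U ∩ H).card : ℤ)),
      ← mul_assoc, mul_inv_cancel₀ hPM.ne', one_mul]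
    refine sum_congr rfl fun c hc => ?_
    obtain ⟨hcodd, h3c, hcT, -⟩ := hdes.2.2.2.1 c hc
    obtain ⟨c₀, rfl⟩ : ∃ c₀, c = c₀ + 2 := ⟨c - 2, by omega⟩
    congr 1
    rw [shellAvg_halfPairs_blockStat_eq M H ψ ht hcodd (by omega) (by omega), hθ, hGs, hκdef]
    simp only [Nat.add_sub_cancel]
    push_cast
    ring
  rw [hval]
  -- Step 2: smoothness of the odd subsequence of `Gs` at odd levels `2i+1`
  have hG' : ∀ x ∈ Icc (0 : ℤ) ((t₀ : ℕ) : ℤ), |ψ (x + 2)| ≤ G := by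
    intro x hx
    refine hG (x + 2) ?_
    rw [mem_Icc] at hx ⊢
    constructor
    · linarith [hx.1]
    · have := hx.2; push_cast at this ⊢; linarith
  have hGodd : ∀ k, D ≤ k + 1 → k ≤ D + 1 → ∀ i : ℕ, 2 * (i + k) + 1 + 2 ≤ T →
      |((fwdDiff (1 : ℕ))^[k] (fun i => Gs (2 * i + 1))) i| ≤ κ * ((H.card : ℝ) ^ 2 * (G * (ρ ^ k * X k))) := by
    intro k hDk hkD i hi
    have hfun : (fun i => Gs (2 * i + 1)) = fun i => κ * ∑ v ∈ H, (fun v i => ∑ w ∈ H \ {v, π v}, φ'' v w (2 * i + 1)) v i := by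
      funext i; rw [hGs]
    rw [hfun, fwdDiff_iter_mul_sum, abs_mul, abs_of_nonneg hκ0]
    refine mul_le_mul_of_nonneg_left ?_ hκ0
    have hsplit : t₀ = (t₀ - 2 * k) + 2 * k := by omega
    have hinner : ∀ v ∈ H, |(fwdDiff (1 : ℕ))^[k] (fun i => ∑ w ∈ H \ {v, π v}, φ'' v w (2 * i + 1)) i| ≤
        (H.card : ℝ) * (G * (ρ ^ k * X k)) := by
      intro v _
      have hfun2 : (fun i => ∑ w ∈ H \ {v, π v}, φ'' v w (2 * i + 1)) =
          fun i => (1 : ℝ) * ∑ w ∈ H \ {v, π v}, (fun w i => φ'' v w (2 * i + 1)) w i := by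
        funext i; rw [one_mul]
      rw [hfun2, fwdDiff_iter_mul_sum, one_mul]
      have hbd : ∀ w' ∈ H \ {v, π v}, |(fwdDiff (1 : ℕ))^[k] (fun i => φ'' v w' (2 * i + 1)) i| ≤ G * (ρ ^ k * X k) := by
        intro w' hw'
        obtain ⟨-, hwe⟩ := mem_sdiff.1 hw'
        rw [mem_insert, mem_singleton, not_or] at hwe
        rw [fwdDiff_iter_one_odd, hφ'']
        simp only
        rw [hsplit]
        refine abs_fwdDiff_iter_del2Profile_le M hwe.1 hwe.2 H ψ hG0 (by rw [← hsplit]; exact hG')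
          (by rw [← hsplit]; exact ht₀) ⟨i, by ring⟩ (by omega) (by omega) hm (by omega) (hX0 k) ?_
        intro S' hS' hcard
        have := hX k hDk hkD (2 * i + 1) ⟨i, by ring⟩ (by omega) S' hS' hcard
        rw [← hsplit]
        convert this using 4
      calc |∑ w' ∈ H \ {v, π v}, (fwdDiff (1 : ℕ))^[k] (fun i => φ'' v w' (2 * i + 1)) i|
          ≤ ∑ w' ∈ H \ {v, π v}, |(fwdDiff (1 : ℕ))^[k] (fun i => φ'' v w' (2 * i + 1)) i| := abs_sum_le_sum_abs _ _
        _ ≤ ∑ w' ∈ H \ {v, π v}, G * (ρ ^ k * X k) := sum_le_sum hbd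
        _ = ((H \ {v, π v}).card : ℝ) * (G * (ρ ^ k * X k)) := by rw [sum_const, nsmul_eq_mul]
        _ ≤ (H.card : ℝ) * (G * (ρ ^ k * X k)) := by
            refine mul_le_mul_of_nonneg_right ?_ (mul_nonneg hG0 (mul_nonneg (pow_nonneg hρ0 k) (hX0 k)))
            exact_mod_cast card_le_card sdiff_subset
    calc |∑ v ∈ H, (fwdDiff (1 : ℕ))^[k] (fun i => ∑ w ∈ H \ {v, π v}, φ'' v w (2 * i + 1)) i|
        ≤ ∑ v ∈ H, |(fwdDiff (1 : ℕ))^[k] (fun i => ∑ w ∈ H \ {v, π v}, φ'' v w (2 * i + 1)) i| := abs_sum_le_sum_abs _ _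
      _ ≤ ∑ v ∈ H, (H.card : ℝ) * (G * (ρ ^ k * X k)) := sum_le_sum hinner
      _ = (H.card : ℝ) ^ 2 * (G * (ρ ^ k * X k)) := by rw [sum_const, nsmul_eq_mul]; ring
  -- Step 3: the odd subsequence of `θ` is `2y · Gs(2y−1)`; Leibniz and the node shift
  have hθodd : (fun y : ℕ => θ (2 * y + 1)) = fun y : ℕ => 2 * (y : ℝ) * (fun y : ℕ => Gs (2 * y - 1)) y := by
    funext y; rw [hθ]; simp only
    rw [show 2 * y + 1 - 2 = 2 * y - 1 by omega]
    push_cast; ring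
  have hK : ∀ k, D ≤ k → k ≤ D + 1 → ∀ y : ℕ, 2 * (y + k) + 1 ≤ T →
      |((fwdDiff (1 : ℕ))^[k] (fun y => θ (2 * y + 1))) y| ≤
        κ * (H.card : ℝ) ^ 2 * (G * ((T : ℝ) * (ρ ^ k * X k) + 2 * (k : ℝ) * (ρ ^ (k - 1) * X (k - 1)))) := by
    intro k hDk hkD y hy
    rw [hθodd, fwdDiff_iter_twoMul]
    have hA0 : ∀ j, 0 ≤ κ * ((H.card : ℝ) ^ 2 * (G * (ρ ^ j * X j))) := fun j =>
      mul_nonneg hκ0 (mul_nonneg (sq_nonneg _) (mul_nonneg hG0 (mul_nonneg (pow_nonneg hρ0 j) (hX0 j))))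
    -- the first term: zero for `y = 0`, a shifted node otherwise
    have h1 : |2 * (y : ℝ) * (fwdDiff (1 : ℕ))^[k] (fun j : ℕ => Gs (2 * j - 1)) y| ≤
        (T : ℝ) * (κ * ((H.card : ℝ) ^ 2 * (G * (ρ ^ k * X k)))) := by
      by_cases hy0 : y = 0
      · rw [hy0]
        simp only [Nat.cast_zero, mul_zero, zero_mul, abs_zero]
        exact mul_nonneg (Nat.cast_nonneg _) (hA0 k)
      · obtain ⟨y', hy'⟩ : ∃ y', y = y' + 1 := ⟨y - 1, by omega⟩
        rw [hy', fwdDiff_iter_predShift, abs_mul, abs_of_nonneg (by positivity : (0 : ℝ) ≤ 2 * ((y' + 1 : ℕ) : ℝ))]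
        have hb := hGodd k (by omega) hkD y' (by omega)
        have hyT : 2 * ((y' + 1 : ℕ) : ℝ) ≤ T := by exact_mod_cast (show 2 * (y' + 1) ≤ T by omega)
        exact mul_le_mul hyT hb (abs_nonneg _) (Nat.cast_nonneg _)
    -- the second term: absent for `k = 0`, a shifted node otherwise
    have h2 : |2 * (k : ℝ) * (fwdDiff (1 : ℕ))^[k - 1] (fun j : ℕ => Gs (2 * j - 1)) (y + 1)| ≤
        2 * (k : ℝ) * (κ * ((H.card : ℝ) ^ 2 * (G * (ρ ^ (k - 1) * X (k - 1))))) := by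
      by_cases hk0 : k = 0
      · rw [hk0]
        simp
      · rw [fwdDiff_iter_predShift, abs_mul, abs_of_nonneg (by positivity : (0 : ℝ) ≤ 2 * (k : ℝ))]
        exact mul_le_mul_of_nonneg_left (hGodd (k - 1) (by omega) (by omega) y (by omega)) (by positivity)
    calc |2 * (y : ℝ) * (fwdDiff (1 : ℕ))^[k] (fun j : ℕ => Gs (2 * j - 1)) y +
            2 * (k : ℝ) * (fwdDiff (1 : ℕ))^[k - 1] (fun j : ℕ => Gs (2 * j - 1)) (y + 1)|
        ≤ |2 * (y : ℝ) * (fwdDiff (1 : ℕ))^[k] (fun j : ℕ => Gs (2 * j - 1)) y| +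
            |2 * (k : ℝ) * (fwdDiff (1 : ℕ))^[k - 1] (fun j : ℕ => Gs (2 * j - 1)) (y + 1)| := abs_add_le _ _
      _ ≤ (T : ℝ) * (κ * ((H.card : ℝ) ^ 2 * (G * (ρ ^ k * X k)))) +
            2 * (k : ℝ) * (κ * ((H.card : ℝ) ^ 2 * (G * (ρ ^ (k - 1) * X (k - 1))))) := add_le_add h1 h2
      _ = κ * (H.card : ℝ) ^ 2 * (G * ((T : ℝ) * (ρ ^ k * X k) + 2 * (k : ℝ) * (ρ ^ (k - 1) * X (k - 1)))) := by ring
  -- Step 4: the abstract remainder estimate of brick 119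
  have hK0 : ∀ k, 0 ≤ κ * (H.card : ℝ) ^ 2 * (G * ((T : ℝ) * (ρ ^ k * X k) + 2 * (k : ℝ) * (ρ ^ (k - 1) * X (k - 1)))) :=
    fun k => mul_nonneg (mul_nonneg hκ0 (sq_nonneg _)) (mul_nonneg hG0 (add_nonneg
      (mul_nonneg (Nat.cast_nonneg _) (mul_nonneg (pow_nonneg hρ0 _) (hX0 _)))
      (mul_nonneg (by positivity) (mul_nonneg (pow_nonneg hρ0 _) (hX0 _)))))
  have hfin := abs_levelSum_levelMul_le hdes.exact hdes.variation_le hdes.level_le (fun c hc => (hdes.2.2.2.1 c hc).1) hDT θ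
    (hK0 D) (hK0 (D + 1)) (fun j hj => hK D le_rfl (by omega) j hj) (fun j hj => hK (D + 1) (by omega) le_rfl j hj)
  have e1 : κ * (H.card : ℝ) ^ 2 = (H.card : ℝ) ^ 2 / ((n : ℝ) * ((n : ℝ) - 2)) := by rw [hκdef]; ring
  rw [e1] at hfin
  simpa only [Nat.cast_add, Nat.cast_one, Nat.add_sub_cancel] using hfin

end Summit.PneNP.PneNP.Theorems.ChebyshevTracialDesignHalfPairsNull

end
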